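import Summits.Ventures.YMGap.RobustBall.TiltedCovariance
import Summits.Ventures.YMGap.RobustBall.LocalSourceLoops
import Summits.Ventures.YMGap.RobustBall.UniformLoopCorrelatorDecay
import HarnessLib

/-!
# Venture YMGap, track ROBUST-BALL (Y2) — A LOCAL SOURCE OF ANY STRENGTH DOES NOT DESTROY THE MASS GAP: the perturbed
# state clusters at the member's rate away from the source

HONEST FRAMING. WHAT THIS IS: a venture file (cell `pub-ymgap`, track Y2 ROBUST-BALL, seat rb-p1, theorems only), the clustering
companion of `LocalSourceOneState[S].lean` (there: the DLR states of `W + V` are exactly the tilts `ν = e^{−H^V}μ/μ(e^{−H^V})` of the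
member's states).  THE IDENTITY (`covariance_tilted_eq`, tool file `TiltedCovariance.lean`): for a probability measure `μ`, a bounded measurable tilt `f` and bounded
measurable `F, G`, with `e = e^{f}`, `Z = μ(e)`:
`cov_{μ.tilted f}(F, G) = cov_μ(eF, G)/Z − (μ(eF)/Z) · cov_μ(e, G)/Z` — the covariance of the TILTED state is a combination of
two covariances of the UNTILTED state, each between an observable supported on `supp f ∪ supp F` and `G`.  Hence
(`abs_covariance_tilted_le`) `|cov_ν(F, G)| ≤ e^{B}|cov_μ(eF, G)| + e^{B} M_F |cov_μ(e, G)|` (`|f| ≤ B`, `|F| ≤ M_F`), and with the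
clustering data `(m, A)` of the member (`PerturbedClustering`, the body of every uniform currency of the track), the Lipschitz
calculus of cylinder functions (`isLipschitzCylinder_exp_of_abs_le`: `e^{−H}` is a Lipschitz cylinder with constant `e^{B} K_H`, via the
Literature bound `abs_exp_sub_exp_le_of_le`;
`isLipschitzCylinder_finset_sum`; ds-1's `isLipschitzCylinder_mul`):
* ★ `abs_cov_tilted_le_of_perturbedClustering` — for every DLR state `μ` of a member clustering with `(m, A)` (`A ≥ 0`), every
  source energy `H` that is a Lipschitz cylinder on `S` (constant `K_S`, `|H| ≤ B`), all Lipschitz cylinders `F` (on `Λ_F`, `|F| ≤ M_F`)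
  and `G` (on `Λ_G`, `|G| ≤ M_G`) with `Λ_G` disjoint from `Λ_F ∪ S`, `|Λ_F ∪ S|, |Λ_G| ≤ n`:
  `|cov_{μ.tilted(−H)}(F, G)| ≤ A n² e^{2B} e^{−m d(Λ_F ∪ S, Λ_G)} (K_F K_G + 2 M_F K_S K_G + 2 M_F M_G)` —
  THE PERTURBED STATE CLUSTERS EXPONENTIALLY, AT THE MEMBER'S RATE `m`, between any observable and any observable far from it
  AND from the source; the source strength enters only through `e^{2B}` and `K_S`;
* lattice forms: `abs_cov_le_of_mem_perturbedGibbsMeasures_add` (tier 1: every DLR state `ν` of `W + V`, `W` with a unique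
  clustering DLR state), `abs_cov_le_of_uniformMassGapOnBallZdG_add` (ds-2's gauge-invariant ball), `abs_cov_le_of_mem_perturbedGibbsMeasuresS_add`
  / `abs_cov_le_of_uniformMassGapOnBallZdS_add` (tier 2, the weighted ball), and ★ `su2_wilson_singleLoop_clustering_upTo_oneTwelfth`:
  for `SU(2)` on `ℤ⁴` at `0 ≤ β_W ≤ 1/12` with ONE WILSON LOOP `t · Re tr U_w/2` OF ANY STRENGTH `t` inserted, the unique DLR state
  `ν_t` satisfies `|cov_{ν_t}(F, G)| ≤ 32 n² e^{2|t|} 2^{−d(Λ_F ∪ w, Λ_G)} (K_F K_G + 2 M_F (|t|√2|w|) K_G + 2 M_F M_G)` — rate `log 2`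
  whatever `t`.
WHAT THIS IS NOT: no decay is claimed between two observables BOTH adjacent to the source but far from each other (the distance
is `d(Λ_F ∪ S, Λ_G)`, or symmetrically `d(Λ_G ∪ S, Λ_F)`); sources with finitely many terms only; lattice, strong coupling (the
rows); nothing about the continuum limit or a Clay-sense mass gap.
-/

noncomputable section

open MeasureTheory Function Finset Real ProbabilityTheory
open scoped NNReal
open Literature.Probability.LatticeModels
open Literature.MathematicalPhysics.QuantumLattice
open Literature.MathematicalPhysics.QuantumFieldTheory hiding ZdEdge Site
open Summit.Ventures.YMGap.ZdSmoothing Summit.Ventures.YMGap.CouplingResponse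

namespace Summit.Ventures.YMGap.RobustBall

variable {d N : ℕ}


/-! ### The perturbed state clusters at the member's rate away from the source -/

section Clustering

variable {β m A : ℝ} {W : Potential (ZdEdge d) (SUN N)} {supp : Finset (ZdEdge d) → Finset (Finset (ZdEdge d))}

/-- ★ **THE TILT OF A CLUSTERING PROBABILITY MEASURE BY A LOCAL DENSITY CLUSTERS AT THE SAME RATE AWAY FROM THE DENSITY'S SUPPORT**
(state-level core: `μ` any probability measure on gauge fields whose covariances of Lipschitz cylinders obey the `(m, A)` clustering bound,
`A ≥ 0`).  `H` a Lipschitz cylinder on `S` (constant `K_S`, `|H| ≤ B`); `F` a Lipschitz cylinder on `Λ_F` (`K_F`, `|F| ≤ M_F`), `G` one on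
`Λ_G` (`K_G`, `|G| ≤ M_G`), `Λ_G` disjoint from `Λ_F ∪ S`, `|Λ_F ∪ S| ≤ n`, `|Λ_G| ≤ n`.  Then
`|cov_{μ.tilted(−H)}(F, G)| ≤ A n² e^{2B} e^{−m d(Λ_F ∪ S, Λ_G)} (K_F K_G + 2 M_F K_S K_G + 2 M_F M_G)`. -/
theorem abs_cov_tilted_le_of_clustering {m A : ℝ} {μ : Measure (LGConfig d (SUN N))} [IsProbabilityMeasure μ]
    (hclμ : ∀ (n : ℕ) (F₁ F₂ : LGConfig d (SUN N) → ℝ) (Λ₁ Λ₂ : Finset (ZdEdge d)) (K₁ K₂ : ℝ≥0),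
      Λ₁.card ≤ n → Λ₂.card ≤ n → Disjoint Λ₁ Λ₂ →
      IsLipschitzCylinder (fundamentalRep (Fin N)) F₁ Λ₁ K₁ → IsLipschitzCylinder (fundamentalRep (Fin N)) F₂ Λ₂ K₂ →
        |cov[F₁, F₂; μ]| ≤ A * (n : ℝ) ^ 2 * Real.exp (-m * setDistEdges Λ₁ Λ₂) *
          ((K₁ : ℝ) * K₂ + Real.sqrt (∫ U, F₁ U ^ 2 ∂μ) * Real.sqrt (∫ U, F₂ U ^ 2 ∂μ)))
    (hA : 0 ≤ A) {H : LGConfig d (SUN N) → ℝ} {S : Finset (ZdEdge d)} {KS : ℝ≥0}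
    (hH : IsLipschitzCylinder (fundamentalRep (Fin N)) H S KS) {B : ℝ} (hHB : ∀ U, |H U| ≤ B)
    {n : ℕ} {F G : LGConfig d (SUN N) → ℝ} {ΛF ΛG : Finset (ZdEdge d)} {KF KG MF MG : ℝ≥0}
    (hF : IsLipschitzCylinder (fundamentalRep (Fin N)) F ΛF KF) (hMF : ∀ U, |F U| ≤ MF)
    (hG : IsLipschitzCylinder (fundamentalRep (Fin N)) G ΛG KG) (hMG : ∀ U, |G U| ≤ MG)
    (hn₁ : (ΛF ∪ S).card ≤ n) (hn₂ : ΛG.card ≤ n) (hdisj : Disjoint (ΛF ∪ S) ΛG) :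
    |cov[F, G; μ.tilted fun U => -H U]| ≤
      A * (n : ℝ) ^ 2 * exp (2 * B) * exp (-m * setDistEdges (ΛF ∪ S) ΛG) *
        ((KF : ℝ) * KG + 2 * MF * KS * KG + 2 * MF * MG) := by
  classical
  set eB : ℝ≥0 := (exp B).toNNReal with heB
  have heBc : (eB : ℝ) = exp B := by rw [heB]; exact Real.coe_toNNReal _ (exp_pos B).le
  -- Lipschitz cylinder data of `e^{-H}` and `e^{-H} F`, both on `ΛF ∪ S`
  have he : IsLipschitzCylinder (fundamentalRep (Fin N)) (fun U => exp (-H U)) (ΛF ∪ S) (eB * KS) :=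
    isLipschitzCylinder_of_subset (isLipschitzCylinder_exp_neg_of_abs_le hH hHB) Finset.subset_union_right
  have heb : ∀ U, |exp (-H U)| ≤ (eB : ℝ) := fun U => by
    rw [abs_of_pos (exp_pos _), heBc]; exact exp_le_exp.2 (by linarith [(abs_le.1 (hHB U)).1])
  have heF : IsLipschitzCylinder (fundamentalRep (Fin N)) (fun U => F U * exp (-H U)) (ΛF ∪ (ΛF ∪ S)) (MF * (eB * KS) + eB * KF) :=
    isLipschitzCylinder_mul hF he hMF heb
  have heF' : IsLipschitzCylinder (fundamentalRep (Fin N)) (fun U => exp (-H U) * F U) (ΛF ∪ S) (MF * (eB * KS) + eB * KF) := by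
    have hset : ΛF ∪ (ΛF ∪ S) = ΛF ∪ S := by rw [← Finset.union_assoc, Finset.union_idempotent]
    rw [hset] at heF
    obtain ⟨g, hg, hgF⟩ := heF
    exact ⟨g, hg, fun U => by have h := hgF U; simp only at h ⊢; rw [mul_comm]; exact h⟩
  -- the two clustering bounds
  have h1 := hclμ n _ G (ΛF ∪ S) ΛG _ KG hn₁ hn₂ hdisj heF' hG
  have h2 := hclμ n _ G (ΛF ∪ S) ΛG _ KG hn₁ hn₂ hdisj he hG
  -- `L²` norms by sup norms
  have hMF0 : (0 : ℝ) ≤ MF := MF.2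
  have hMG0 : (0 : ℝ) ≤ MG := MG.2
  have heb' : ∀ U, |exp (-H U)| ≤ exp B := fun U => heBc ▸ heb U
  have sF : Real.sqrt (∫ U, (exp (-H U) * F U) ^ 2 ∂μ) ≤ exp B * MF :=
    sqrt_integral_sq_le (by positivity) fun U => by
      rw [abs_mul]; exact mul_le_mul (heb' U) (hMF U) (abs_nonneg _) (exp_pos B).le
  have se : Real.sqrt (∫ U, (exp (-H U)) ^ 2 ∂μ) ≤ exp B := sqrt_integral_sq_le (exp_pos B).le heb'
  have sG : Real.sqrt (∫ U, G U ^ 2 ∂μ) ≤ MG := sqrt_integral_sq_le hMG0 hMG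
  set E : ℝ := A * (n : ℝ) ^ 2 * exp (-m * setDistEdges (ΛF ∪ S) ΛG) with hE
  have hE0 : 0 ≤ E := by positivity
  have h1' : |cov[fun U => exp (-H U) * F U, G; μ]| ≤ E * ((MF * (exp B * KS) + exp B * KF) * KG + exp B * MF * MG) := by
    refine h1.trans (mul_le_mul_of_nonneg_left (add_le_add (le_of_eq ?_) ?_) hE0)
    · push_cast [heBc]; ring
    · exact mul_le_mul sF sG (Real.sqrt_nonneg _) (by positivity)
  have h2' : |cov[fun U => exp (-H U), G; μ]| ≤ E * (exp B * KS * KG + exp B * MG) := by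
    refine h2.trans (mul_le_mul_of_nonneg_left (add_le_add (le_of_eq ?_) ?_) hE0)
    · push_cast [heBc]; ring
    · exact mul_le_mul se sG (Real.sqrt_nonneg _) (exp_pos B).le
  -- assemble
  have hab := abs_covariance_tilted_le (μ := μ) (f := fun U => -H U) hH.measurable.neg (B := B)
    (fun U => by rw [abs_neg]; exact hHB U) hF.measurable hMF hG.measurable hMG
  have hexp2 : exp (2 * B) = exp B * exp B := by rw [← Real.exp_add]; ring_nf
  calc |cov[F, G; μ.tilted fun U => -H U]|
      ≤ exp B * |cov[fun U => exp (-H U) * F U, G; μ]| + exp B * MF * |cov[fun U => exp (-H U), G; μ]| := hab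
    _ ≤ exp B * (E * ((MF * (exp B * KS) + exp B * KF) * KG + exp B * MF * MG)) +
        exp B * MF * (E * (exp B * KS * KG + exp B * MG)) :=
        add_le_add (mul_le_mul_of_nonneg_left h1' (exp_pos B).le) (mul_le_mul_of_nonneg_left h2' (by positivity))
    _ = A * (n : ℝ) ^ 2 * exp (2 * B) * exp (-m * setDistEdges (ΛF ∪ S) ΛG) *
        ((KF : ℝ) * KG + 2 * MF * KS * KG + 2 * MF * MG) := by rw [hexp2, hE]; ring

/-- **Member level (tier 1)**: `μ` a DLR state of a member with `PerturbedClustering d N β W supp m A` (`A ≥ 0`) — the bound of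
`abs_cov_tilted_le_of_clustering` for `μ.tilted (−H)`. -/
theorem abs_cov_tilted_le_of_perturbedClustering (hcl : PerturbedClustering d N β W supp m A) (hA : 0 ≤ A)
    {μ : Measure (LGConfig d (SUN N))} (hμ : μ ∈ perturbedGibbsMeasures (d := d) (fundamentalRep (Fin N)) (N * β) W supp)
    {H : LGConfig d (SUN N) → ℝ} {S : Finset (ZdEdge d)} {KS : ℝ≥0}
    (hH : IsLipschitzCylinder (fundamentalRep (Fin N)) H S KS) {B : ℝ} (hHB : ∀ U, |H U| ≤ B)
    {n : ℕ} {F G : LGConfig d (SUN N) → ℝ} {ΛF ΛG : Finset (ZdEdge d)} {KF KG MF MG : ℝ≥0}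
    (hF : IsLipschitzCylinder (fundamentalRep (Fin N)) F ΛF KF) (hMF : ∀ U, |F U| ≤ MF)
    (hG : IsLipschitzCylinder (fundamentalRep (Fin N)) G ΛG KG) (hMG : ∀ U, |G U| ≤ MG)
    (hn₁ : (ΛF ∪ S).card ≤ n) (hn₂ : ΛG.card ≤ n) (hdisj : Disjoint (ΛF ∪ S) ΛG) :
    |cov[F, G; μ.tilted fun U => -H U]| ≤
      A * (n : ℝ) ^ 2 * exp (2 * B) * exp (-m * setDistEdges (ΛF ∪ S) ΛG) *
        ((KF : ℝ) * KG + 2 * MF * KS * KG + 2 * MF * MG) := by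
  haveI := (show IsGibbsMeasure _ μ from hμ).isProbabilityMeasure
  exact abs_cov_tilted_le_of_clustering (hcl μ hμ) hA hH hHB hF hMF hG hMG hn₁ hn₂ hdisj

/-- **Member level (tier 2)**: the same for a DLR state of the SUMMABLE member with `PerturbedClusteringS d N β W m A`. -/
theorem abs_cov_tilted_le_of_perturbedClusteringS (hcl : PerturbedClusteringS d N β W m A) (hA : 0 ≤ A)
    {μ : Measure (LGConfig d (SUN N))} (hμ : μ ∈ perturbedGibbsMeasuresS (d := d) (fundamentalRep (Fin N)) (N * β) W)
    {H : LGConfig d (SUN N) → ℝ} {S : Finset (ZdEdge d)} {KS : ℝ≥0}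
    (hH : IsLipschitzCylinder (fundamentalRep (Fin N)) H S KS) {B : ℝ} (hHB : ∀ U, |H U| ≤ B)
    {n : ℕ} {F G : LGConfig d (SUN N) → ℝ} {ΛF ΛG : Finset (ZdEdge d)} {KF KG MF MG : ℝ≥0}
    (hF : IsLipschitzCylinder (fundamentalRep (Fin N)) F ΛF KF) (hMF : ∀ U, |F U| ≤ MF)
    (hG : IsLipschitzCylinder (fundamentalRep (Fin N)) G ΛG KG) (hMG : ∀ U, |G U| ≤ MG)
    (hn₁ : (ΛF ∪ S).card ≤ n) (hn₂ : ΛG.card ≤ n) (hdisj : Disjoint (ΛF ∪ S) ΛG) :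
    |cov[F, G; μ.tilted fun U => -H U]| ≤
      A * (n : ℝ) ^ 2 * exp (2 * B) * exp (-m * setDistEdges (ΛF ∪ S) ΛG) *
        ((KF : ℝ) * KG + 2 * MF * KS * KG + 2 * MF * MG) := by
  haveI := (show IsGibbsMeasure _ μ from hμ).isProbabilityMeasure
  exact abs_cov_tilted_le_of_clustering (hcl μ hμ) hA hH hHB hF hMF hG hMG hn₁ hn₂ hdisj

/-- **TIER 1 — EVERY DLR STATE OF `W + V` CLUSTERS AT THE MEMBER'S RATE AWAY FROM THE SOURCE.** Adapted bounded `W` listed by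
`supp` with at most one DLR state `μ`, clustering with `(m, A)`; source `V` (adapted, bounded, listed by `suppV ⊆ T`) whose terms
`V_X`, `X ∈ T`, are Lipschitz cylinders on `X ⊆ S` (constants `K_X`) with `|Σ_X V_X| ≤ B`.  Then every DLR state `ν` of `W + V`
satisfies, for Lipschitz cylinders `F` (`Λ_F`, `K_F`, `|F| ≤ M_F`), `G` (`Λ_G`, `K_G`, `|G| ≤ M_G`) with `Λ_G ∩ (Λ_F ∪ S) = ∅`,
`|Λ_F ∪ S|, |Λ_G| ≤ n`:
`|cov_ν(F, G)| ≤ A n² e^{2B} e^{−m d(Λ_F ∪ S, Λ_G)} (K_F K_G + 2 M_F (Σ_X K_X) K_G + 2 M_F M_G)`. -/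
theorem abs_cov_le_of_mem_perturbedGibbsMeasures_add (hcl : PerturbedClustering d N β W supp m A) (hA : 0 ≤ A)
    (hWa : W.IsAdapted) (hWb : ∀ X, ∃ C, ∀ U, |W X U| ≤ C) (hsupp : W.IsSupportedBy supp)
    (huniq : (perturbedGibbsMeasures (d := d) (fundamentalRep (Fin N)) (N * β) W supp).Subsingleton)
    {μ : Measure (LGConfig d (SUN N))} (hμ : μ ∈ perturbedGibbsMeasures (d := d) (fundamentalRep (Fin N)) (N * β) W supp)
    {V : Potential (ZdEdge d) (SUN N)} (hVa : V.IsAdapted) (hVb : ∀ X, ∃ C, ∀ U, |V X U| ≤ C)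
    {suppV : Finset (ZdEdge d) → Finset (Finset (ZdEdge d))} (hsuppV : V.IsSupportedBy suppV)
    {T : Finset (Finset (ZdEdge d))} (hT : ∀ Λ, suppV Λ ⊆ T)
    {K : Finset (ZdEdge d) → ℝ≥0} (hV : ∀ X ∈ T, IsLipschitzCylinder (fundamentalRep (Fin N)) (V X) X (K X))
    {S : Finset (ZdEdge d)} (hS : ∀ X ∈ T, X ⊆ S) {B : ℝ} (hB : ∀ U, |∑ X ∈ T, V X U| ≤ B)
    {ν : Measure (LGConfig d (SUN N))}
    (hν : ν ∈ perturbedGibbsMeasures (d := d) (fundamentalRep (Fin N)) (N * β) (W + V) (fun Λ => supp Λ ∪ suppV Λ))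
    {n : ℕ} {F G : LGConfig d (SUN N) → ℝ} {ΛF ΛG : Finset (ZdEdge d)} {KF KG MF MG : ℝ≥0}
    (hF : IsLipschitzCylinder (fundamentalRep (Fin N)) F ΛF KF) (hMF : ∀ U, |F U| ≤ MF)
    (hG : IsLipschitzCylinder (fundamentalRep (Fin N)) G ΛG KG) (hMG : ∀ U, |G U| ≤ MG)
    (hn₁ : (ΛF ∪ S).card ≤ n) (hn₂ : ΛG.card ≤ n) (hdisj : Disjoint (ΛF ∪ S) ΛG) :
    |cov[F, G; ν]| ≤ A * (n : ℝ) ^ 2 * exp (2 * B) * exp (-m * setDistEdges (ΛF ∪ S) ΛG) *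
      ((KF : ℝ) * KG + 2 * MF * (∑ X ∈ T, K X : ℝ≥0) * KG + 2 * MF * MG) := by
  haveI : SecondCountableTopology (Matrix (Fin N) (Fin N) ℂ) :=
    inferInstanceAs (SecondCountableTopology (Fin N → Fin N → ℂ))
  haveI : SecondCountableTopology (SUN N) := Topology.IsEmbedding.subtypeVal.secondCountableTopology
  have hνeq := eq_tilted_of_mem_perturbedGibbsMeasures_add (fundamentalRep (Fin N)) (continuous_fundamentalRep (Fin N)) (N * β)
    hWa hWb hsupp hVa hVb hsuppV hT huniq hμ hν
  rw [hνeq]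
  exact abs_cov_tilted_le_of_perturbedClustering hcl hA hμ (isLipschitzCylinder_finset_sum hV hS) hB hF hMF hG hMG hn₁ hn₂ hdisj

/-- **ON ds-2's GAUGE-INVARIANT BALL**: for every member of `MemBallZdG ε₀ ε₁ R` of a ball with
`UniformMassGapOnBallZdG d N β ε₀ ε₁ R m A` (`A ≥ 0`), every source as above and EVERY DLR state `ν` of `W + V`, the clustering
bound of `abs_cov_le_of_mem_perturbedGibbsMeasures_add` holds with the ball's `(m, A)`. -/
theorem abs_cov_le_of_uniformMassGapOnBallZdG_add {ε₀ ε₁ : ℝ} {R : ℕ} (h : UniformMassGapOnBallZdG d N β ε₀ ε₁ R m A)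
    (hA : 0 ≤ A) (hW : MemBallZdG ε₀ ε₁ R W supp)
    {V : Potential (ZdEdge d) (SUN N)} (hVa : V.IsAdapted) (hVb : ∀ X, ∃ C, ∀ U, |V X U| ≤ C)
    {suppV : Finset (ZdEdge d) → Finset (Finset (ZdEdge d))} (hsuppV : V.IsSupportedBy suppV)
    {T : Finset (Finset (ZdEdge d))} (hT : ∀ Λ, suppV Λ ⊆ T)
    {K : Finset (ZdEdge d) → ℝ≥0} (hV : ∀ X ∈ T, IsLipschitzCylinder (fundamentalRep (Fin N)) (V X) X (K X))
    {S : Finset (ZdEdge d)} (hS : ∀ X ∈ T, X ⊆ S) {B : ℝ} (hB : ∀ U, |∑ X ∈ T, V X U| ≤ B)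
    {ν : Measure (LGConfig d (SUN N))}
    (hν : ν ∈ perturbedGibbsMeasures (d := d) (fundamentalRep (Fin N)) (N * β) (W + V) (fun Λ => supp Λ ∪ suppV Λ))
    {n : ℕ} {F G : LGConfig d (SUN N) → ℝ} {ΛF ΛG : Finset (ZdEdge d)} {KF KG MF MG : ℝ≥0}
    (hF : IsLipschitzCylinder (fundamentalRep (Fin N)) F ΛF KF) (hMF : ∀ U, |F U| ≤ MF)
    (hG : IsLipschitzCylinder (fundamentalRep (Fin N)) G ΛG KG) (hMG : ∀ U, |G U| ≤ MG)
    (hn₁ : (ΛF ∪ S).card ≤ n) (hn₂ : ΛG.card ≤ n) (hdisj : Disjoint (ΛF ∪ S) ΛG) :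
    |cov[F, G; ν]| ≤ A * (n : ℝ) ^ 2 * exp (2 * B) * exp (-m * setDistEdges (ΛF ∪ S) ΛG) *
      ((KF : ℝ) * KG + 2 * MF * (∑ X ∈ T, K X : ℝ≥0) * KG + 2 * MF * MG) := by
  have hWa : W.IsAdapted := fun X => ⟨hW.dependsOn X, (hW.continuous X).measurable⟩
  have hWb : ∀ X, ∃ C, ∀ U, |W X U| ≤ C := fun X => exists_bound_of_continuous (hW.continuous X)
  obtain ⟨μ, hμ⟩ := (h.2 W supp hW).1.2
  exact abs_cov_le_of_mem_perturbedGibbsMeasures_add (h.2 W supp hW).2 hA hWa hWb hW.supportedBy (h.2 W supp hW).1.1 hμ hVa hVb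
    hsuppV hT hV hS hB hν hF hMF hG hMG hn₁ hn₂ hdisj

/-- **TIER 2 — EVERY DLR STATE OF THE SUMMABLE MEMBER `W + V` CLUSTERS AT THE MEMBER'S RATE AWAY FROM THE SOURCE** (`W` link-summable
with continuous own-link terms and at most one DLR state `μ`, clustering with `PerturbedClusteringS d N β W m A`; source with
continuous own-link Lipschitz-cylinder terms). -/
theorem abs_cov_le_of_mem_perturbedGibbsMeasuresS_add (hcl : PerturbedClusteringS d N β W m A) (hA : 0 ≤ A)
    {Bm : Finset (ZdEdge d) → ℝ} (hWs : IsLinkSummable W Bm) (hWc : ∀ X, Continuous (W X))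
    (hWdep : ∀ X, DependsOn (W X) (↑X : Set (ZdEdge d)))
    (huniq : (perturbedGibbsMeasuresS (d := d) (fundamentalRep (Fin N)) (N * β) W).Subsingleton)
    {μ : Measure (LGConfig d (SUN N))} (hμ : μ ∈ perturbedGibbsMeasuresS (d := d) (fundamentalRep (Fin N)) (N * β) W)
    {V : Potential (ZdEdge d) (SUN N)} (hVc : ∀ X, Continuous (V X)) (hVdep : ∀ X, DependsOn (V X) (↑X : Set (ZdEdge d)))
    {suppV : Finset (ZdEdge d) → Finset (Finset (ZdEdge d))} (hsuppV : V.IsSupportedBy suppV)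
    {T : Finset (Finset (ZdEdge d))} (hT : ∀ Λ, suppV Λ ⊆ T)
    {K : Finset (ZdEdge d) → ℝ≥0} (hV : ∀ X ∈ T, IsLipschitzCylinder (fundamentalRep (Fin N)) (V X) X (K X))
    {S : Finset (ZdEdge d)} (hS : ∀ X ∈ T, X ⊆ S) {B : ℝ} (hB : ∀ U, |∑ X ∈ T, V X U| ≤ B)
    {ν : Measure (LGConfig d (SUN N))}
    (hν : ν ∈ perturbedGibbsMeasuresS (d := d) (fundamentalRep (Fin N)) (N * β) (W + V))
    {n : ℕ} {F G : LGConfig d (SUN N) → ℝ} {ΛF ΛG : Finset (ZdEdge d)} {KF KG MF MG : ℝ≥0}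
    (hF : IsLipschitzCylinder (fundamentalRep (Fin N)) F ΛF KF) (hMF : ∀ U, |F U| ≤ MF)
    (hG : IsLipschitzCylinder (fundamentalRep (Fin N)) G ΛG KG) (hMG : ∀ U, |G U| ≤ MG)
    (hn₁ : (ΛF ∪ S).card ≤ n) (hn₂ : ΛG.card ≤ n) (hdisj : Disjoint (ΛF ∪ S) ΛG) :
    |cov[F, G; ν]| ≤ A * (n : ℝ) ^ 2 * exp (2 * B) * exp (-m * setDistEdges (ΛF ∪ S) ΛG) *
      ((KF : ℝ) * KG + 2 * MF * (∑ X ∈ T, K X : ℝ≥0) * KG + 2 * MF * MG) := by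
  haveI : SecondCountableTopology (Matrix (Fin N) (Fin N) ℂ) :=
    inferInstanceAs (SecondCountableTopology (Fin N → Fin N → ℂ))
  haveI : SecondCountableTopology (SUN N) := Topology.IsEmbedding.subtypeVal.secondCountableTopology
  have hνeq := eq_tilted_of_mem_perturbedGibbsMeasuresS_add (fundamentalRep (Fin N)) (continuous_fundamentalRep (Fin N)) (N * β)
    hWs hWc hWdep hVc hVdep hsuppV hT huniq hμ hν
  rw [hνeq]
  exact abs_cov_tilted_le_of_perturbedClusteringS hcl hA hμ (isLipschitzCylinder_finset_sum hV hS) hB hF hMF hG hMG hn₁ hn₂ hdisj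

/-- **ON THE WEIGHTED TIER-2 BALL** (`UniformMassGapOnBallZdS d N β a Λ t m A`, `A ≥ 0`, member `W ∈ MemBallZdS a Λ t`): every DLR
state of `W + V` obeys the clustering bound of `abs_cov_le_of_mem_perturbedGibbsMeasuresS_add` with the row's `(m, A)`. -/
theorem abs_cov_le_of_uniformMassGapOnBallZdS_add {a Λ t : ℝ} (h : UniformMassGapOnBallZdS d N β a Λ t m A) (hA : 0 ≤ A)
    (hW : MemBallZdS a Λ t W)
    {V : Potential (ZdEdge d) (SUN N)} (hVc : ∀ X, Continuous (V X)) (hVdep : ∀ X, DependsOn (V X) (↑X : Set (ZdEdge d)))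
    {suppV : Finset (ZdEdge d) → Finset (Finset (ZdEdge d))} (hsuppV : V.IsSupportedBy suppV)
    {T : Finset (Finset (ZdEdge d))} (hT : ∀ Λ, suppV Λ ⊆ T)
    {K : Finset (ZdEdge d) → ℝ≥0} (hV : ∀ X ∈ T, IsLipschitzCylinder (fundamentalRep (Fin N)) (V X) X (K X))
    {S : Finset (ZdEdge d)} (hS : ∀ X ∈ T, X ⊆ S) {B : ℝ} (hB : ∀ U, |∑ X ∈ T, V X U| ≤ B)
    {ν : Measure (LGConfig d (SUN N))}
    (hν : ν ∈ perturbedGibbsMeasuresS (d := d) (fundamentalRep (Fin N)) (N * β) (W + V))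
    {n : ℕ} {F G : LGConfig d (SUN N) → ℝ} {ΛF ΛG : Finset (ZdEdge d)} {KF KG MF MG : ℝ≥0}
    (hF : IsLipschitzCylinder (fundamentalRep (Fin N)) F ΛF KF) (hMF : ∀ U, |F U| ≤ MF)
    (hG : IsLipschitzCylinder (fundamentalRep (Fin N)) G ΛG KG) (hMG : ∀ U, |G U| ≤ MG)
    (hn₁ : (ΛF ∪ S).card ≤ n) (hn₂ : ΛG.card ≤ n) (hdisj : Disjoint (ΛF ∪ S) ΛG) :
    |cov[F, G; ν]| ≤ A * (n : ℝ) ^ 2 * exp (2 * B) * exp (-m * setDistEdges (ΛF ∪ S) ΛG) *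
      ((KF : ℝ) * KG + 2 * MF * (∑ X ∈ T, K X : ℝ≥0) * KG + 2 * MF * MG) := by
  obtain ⟨Bm, hBm⟩ := hW.summable
  obtain ⟨μ, hμ⟩ := (h.2 W hW).1.2
  exact abs_cov_le_of_mem_perturbedGibbsMeasuresS_add (h.2 W hW).2 hA hBm hW.continuous hW.dependsOn (h.2 W hW).1.1 hμ hVc hVdep
    hsuppV hT hV hS hB hν hF hMF hG hMG hn₁ hn₂ hdisj

end Clustering

/-! ### The Wilson point with one loop of any strength: the mass gap survives -/

section WilsonLoop

/-- ★ **`SU(2)` ON `ℤ⁴`, `0 ≤ β_W ≤ 1/12`, ONE WILSON LOOP OF ANY STRENGTH: THE MASS GAP SURVIVES.** For every closed walk `w`,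
every real `t`, and every DLR state `ν` of the Wilson action at `β_W` (tree coupling `β_W/2`) with `t · Re tr U_w/2` inserted
(there is exactly one), all Lipschitz cylinders `F` (`Λ_F`, `K_F`, `|F| ≤ M_F`) and `G` (`Λ_G`, `K_G`, `|G| ≤ M_G`) with
`Λ_G` disjoint from `Λ_F ∪ links(w)`, `|Λ_F ∪ links(w)|, |Λ_G| ≤ n`:
`|cov_ν(F, G)| ≤ 32 n² e^{2|t|} 2^{−d(Λ_F ∪ w, Λ_G)} (K_F K_G + 2 M_F (|t|√2|w|) K_G + 2 M_F M_G)` — exponential clustering at the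
Wilson rate `log 2` of `su2_wilson_clustering_upTo_oneTwelfth`, whatever the loop strength. -/
theorem su2_wilson_singleLoop_clustering_upTo_oneTwelfth {βW : ℝ} (h0 : 0 ≤ βW) (h1 : βW ≤ 1 / 12)
    {x : Literature.Probability.LatticeModels.Site 4} (w : (zdGraph 4).Walk x x) (t : ℝ)
    {ν : Measure (LGConfig 4 (SUN 2))}
    (hν : ν ∈ perturbedGibbsMeasures (d := 4) (fundamentalRep (Fin 2)) (2 * (βW / 4))
      (loopFamilyAction 2 (fun _ : Unit => (⟨x, w⟩ : ZdLoop 4)) (fun _ => t))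
      (loopSupp (fun _ : Unit => (⟨x, w⟩ : ZdLoop 4))))
    {n : ℕ} {F G : LGConfig 4 (SUN 2) → ℝ} {ΛF ΛG : Finset (ZdEdge 4)} {KF KG MF MG : ℝ≥0}
    (hF : IsLipschitzCylinder (fundamentalRep (Fin 2)) F ΛF KF) (hMF : ∀ U, |F U| ≤ MF)
    (hG : IsLipschitzCylinder (fundamentalRep (Fin 2)) G ΛG KG) (hMG : ∀ U, |G U| ≤ MG)
    (hn₁ : (ΛF ∪ walkEdges w).card ≤ n) (hn₂ : ΛG.card ≤ n) (hdisj : Disjoint (ΛF ∪ walkEdges w) ΛG) :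
    |cov[F, G; ν]| ≤ 32 * (n : ℝ) ^ 2 * exp (2 * |t|) * exp (-Real.log 2 * setDistEdges (ΛF ∪ walkEdges w) ΛG) *
      ((KF : ℝ) * KG + 2 * MF * (|t| * Real.sqrt (2 : ℕ) * w.length) * KG + 2 * MF * MG) := by
  classical
  set γ : Unit → ZdLoop 4 := fun _ => ⟨x, w⟩ with hγ
  -- the Wilson point as the zero member, clustering at rate log 2 with constant 32
  have hcl := su2_wilson_clustering_upTo_oneTwelfth h0 h1
  have hW0a : (0 : Potential (ZdEdge 4) (SUN 2)).IsAdapted := fun X => ⟨fun _ _ _ => rfl, measurable_const⟩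
  have hW0b : ∀ X, ∃ C, ∀ U, |(0 : Potential (ZdEdge 4) (SUN 2)) X U| ≤ C := fun X => ⟨0, fun U => by simp⟩
  have hW0s : (0 : Potential (ZdEdge 4) (SUN 2)).IsSupportedBy fun _ => (∅ : Finset (Finset (ZdEdge 4))) :=
    fun Λ X _ h0 => absurd rfl h0
  -- uniqueness of the Wilson state (`β_W ≤ 1/12 ≤ 1/3`)
  have h13 : βW ≤ 1 / 3 := h1.trans (by norm_num)
  have huq := su2_wilson_singleLoop_hasUniqueGibbsMeasure_upTo_oneThird h0 h13 w 0
  rw [loopFamilyAction_zero] at huq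
  have eγ : perturbedGibbsMeasures (d := 4) (fundamentalRep (Fin 2)) (2 * (βW / 4)) 0 (loopSupp γ) =
      ymGibbsMeasures (d := 4) (fundamentalRep (Fin 2)) (2 * (βW / 4)) := perturbedGibbsMeasures_zero _ _ _
  have e0 : perturbedGibbsMeasures (d := 4) (fundamentalRep (Fin 2)) (2 * (βW / 4)) 0
      (fun _ => (∅ : Finset (Finset (ZdEdge 4)))) = ymGibbsMeasures (d := 4) (fundamentalRep (Fin 2)) (2 * (βW / 4)) :=
    perturbedGibbsMeasures_zero _ _ _
  have huniq : (perturbedGibbsMeasures (d := 4) (fundamentalRep (Fin 2)) (2 * (βW / 4)) 0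
      (fun _ => (∅ : Finset (Finset (ZdEdge 4))))).Subsingleton := by
    rw [e0, ← eγ]; exact huq.1
  obtain ⟨μ, hμ⟩ := huq.2
  have hμ0 : μ ∈ perturbedGibbsMeasures (d := 4) (fundamentalRep (Fin 2)) (2 * (βW / 4)) 0
      (fun _ => (∅ : Finset (Finset (ZdEdge 4)))) := by
    rw [e0, ← eγ]; exact hμ
  -- the source data
  have hV := memBallZd_loopFamilyAction_fintype (N := 2) γ fun _ => t
  have hVa : (loopFamilyAction (d := 4) 2 γ fun _ => t).IsAdapted := fun X => ⟨hV.dependsOn X, (hV.continuous X).measurable⟩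
  have hVb : ∀ X, ∃ C, ∀ U, |loopFamilyAction (d := 4) 2 γ (fun _ => t) X U| ≤ C := fun X =>
    exists_bound_of_continuous (hV.continuous X)
  have hT : ∀ Λ, loopSupp γ Λ ⊆ Finset.univ.image fun i => walkEdges (γ i).walk := fun Λ =>
    Finset.image_subset_image (Finset.subset_univ _)
  have himg : (Finset.univ : Finset Unit).image (fun i => walkEdges (γ i).walk) = {walkEdges w} := by
    ext X
    simp only [Finset.mem_image, Finset.mem_univ, true_and, Finset.mem_singleton]
    exact ⟨fun ⟨_, h⟩ => h.symm, fun h => ⟨(), h.symm⟩⟩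
  set Kc : Finset (ZdEdge 4) → ℝ≥0 := fun _ => ⟨|t| * Real.sqrt (2 : ℕ) * w.length, by positivity⟩ with hKc
  have hKcc : ∀ X, (Kc X : ℝ) = |t| * Real.sqrt (2 : ℕ) * w.length := fun X => by rw [hKc]; rfl
  have hVL : ∀ X ∈ Finset.univ.image (fun i => walkEdges (γ i).walk),
      IsLipschitzCylinder (fundamentalRep (Fin 2)) (loopFamilyAction (d := 4) 2 γ (fun _ => t) X) X (Kc X) := by
    intro X hX
    rw [himg, Finset.mem_singleton] at hX
    subst hX
    rw [loopFamilyAction_single_apply]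
    exact isLipschitzCylinder_loopTerm (N := 2) t w
  have hS : ∀ X ∈ Finset.univ.image (fun i => walkEdges (γ i).walk), X ⊆ walkEdges w := by
    intro X hX
    rw [himg, Finset.mem_singleton] at hX
    exact hX.le
  have hB : ∀ U, |∑ X ∈ Finset.univ.image (fun i => walkEdges (γ i).walk), loopFamilyAction (d := 4) 2 γ (fun _ => t) X U| ≤ |t| := by
    intro U
    rw [himg, Finset.sum_singleton, loopFamilyAction_single_apply]
    exact abs_loopTerm_le w U
  have hν' : ν ∈ perturbedGibbsMeasures (d := 4) (fundamentalRep (Fin 2)) (2 * (βW / 4))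
      (0 + loopFamilyAction (d := 4) 2 γ fun _ => t) (fun Λ => (∅ : Finset (Finset (ZdEdge 4))) ∪ loopSupp γ Λ) := by
    simpa only [zero_add, Finset.empty_union] using hν
  have key := abs_cov_le_of_mem_perturbedGibbsMeasures_add hcl (by norm_num) hW0a hW0b hW0s huniq hμ0 hVa hVb hV.supportedBy hT
    hVL hS hB hν' hF hMF hG hMG hn₁ hn₂ hdisj
  have hsum : ((∑ X ∈ Finset.univ.image (fun i => walkEdges (γ i).walk), Kc X : ℝ≥0) : ℝ) =
      |t| * Real.sqrt (2 : ℕ) * w.length := by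
    rw [himg, Finset.sum_singleton]; exact hKcc (walkEdges w)
  rw [hsum] at key
  exact key

end WilsonLoop

end Summit.Ventures.YMGap.RobustBall

end
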